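import Literature.NumberTheory.Transcendental.KZCubicalCalculus
import Literature.NumberTheory.Transcendental.KZSemialgebraicComplex
import Summits.KontsevichZagierPeriods.KontsevichZagierPeriods.Theorems.FurushoPentagonPentagonInKZSimplexToCube

/-!
# `ReductionRigidity` (stmt-KontsevichZagierPeriods-3407), line `Sketch` (growth line
# `bloch-suslin-rational-dilog`): the box–triangle bridge (`stub_boxTriangleBridge`)

Route `KontsevichZagierPeriods/HermiteRigidity`, crux `ReductionRigidity` (stmt-3407), registered
sub-goal stub `stub_boxTriangleBridge`. For a real ALGEBRAIC parameter `0 < a ≤ 1` it identifies,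
inside the Kontsevich–Zagier calculus of moves, this crux's BOX syntax for the dilogarithm,

  `[□², a/(1 − a p₀ p₁)]`   (value `Li₂(a)`),

with the TRIANGLE (iterated-integral) syntax of the crux `OffTetraSectorKernel` (stmt-10557),

  `[{0 < v < u < a}, 1/(u(1 − v))]`   (`u = w 0`, `v = w 1`):

`[□², a/(1 − a p₀ p₁)] − [{0 < v < u < a}, 1/(u(1 − v))] ∈ KZ.relations`.

Proof: TWO moves.
* Rule (1a): `[□², f] ≡ [(0,1)², f]`, the boundary `□² ∖ (0,1)²` being Lebesgue-null
  (`SimplexToCube.volume_cube_diff_openUnitCube`,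
  `KZ.IntegralRep.of_sub_of_restrict_mem_relations`). For `a = 1` the box is Kontsevich–Zagier's
  singular `ζ(2)` corner, which is why the integrand of the box is only prescribed off
  `{a p₀ p₁ = 1}`; on the open square `a p₀ p₁ < 1` always holds.
* Rule (2): ONE change of variables along `Φ(p, q) = (a p, a p q)`, which maps `(0,1)²`
  bijectively onto the triangle `{0 < v < u < a}` (inverse `(u, v) ↦ (u/a, v/u)`), is a
  `ℚ`-semialgebraic map because `a` is real algebraic
  (`isSemialgebraicFunOn_const_of_isAlgebraic`), has derivative `!![a, 0; a q, a p]` of determinant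
  `a² p > 0`, and pulls `du dv/(u(1 − v))` back to `a² p/((a p)(1 − a p q)) = a/(1 − a p q)`.

Pattern of `HyperbolicBlochOffTetraSectorKernelStubDilogLanden.lean` (the chart is passed to the
helper lemmas as a hypothesis `hΦ : ∀ p, Φ p = ![a * p 0, a * p 0 * p 1]`; no definitions are
introduced, so that the file is a pure proof file).

References: M. Kontsevich, D. Zagier, *Periods* (2001), §1.2 rules (1), (2)
[cite: KontsevichZagier2001, §1.2]; J. Bochnak, M. Coste, M.-F. Roy, *Real Algebraic Geometry*
(1998), §2.2.
-/

noncomputable section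

open MeasureTheory Set MvPolynomial

namespace Summit.KontsevichZagierPeriods.HermiteRigidity.ReductionRigidity

open Literature.NumberTheory.Transcendental
open Literature.NumberTheory.Transcendental.KZ
open Literature.ModelTheory.ExponentialFields (IsSemialgebraic)

/-! ### The open square inside the box -/

/-- Coordinates of a point of the open square `(0,1)²`. [folklore] -/
theorem boxTriangle_mem_open {p : Fin 2 → ℝ} (hp : p ∈ openUnitCube 2) :
    0 < p 0 ∧ p 0 < 1 ∧ 0 < p 1 ∧ p 1 < 1 :=
  ⟨(hp 0).1, (hp 0).2, (hp 1).1, (hp 1).2⟩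

/-- On the open square the singular locus `{a p₀ p₁ = 1}` is avoided: `a p₀ p₁ < 1` for
`0 < a ≤ 1`, `0 < p₀ < 1`, `p₁ < 1`. [folklore] -/
theorem boxTriangle_prod_lt_one {a p q : ℝ} (ha0 : 0 < a) (ha1 : a ≤ 1) (hp0 : 0 < p)
    (hp1 : p < 1) (hq1 : q < 1) : a * p * q < 1 := by
  have h1 : a * p < 1 :=
    calc a * p ≤ 1 * p := mul_le_mul_of_nonneg_right ha1 hp0.le
      _ = p := one_mul p
      _ < 1 := hp1
  have h2 : a * p * q < a * p :=
    calc a * p * q < a * p * 1 := mul_lt_mul_of_pos_left hq1 (mul_pos ha0 hp0)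
      _ = a * p := mul_one _
  exact h2.trans h1

/-- The Jacobian identity behind rule (2) (`a ≠ 0`, `p ≠ 0`, `1 − a p q ≠ 0`):
`a/(1 − a p q) = [1/(u(1 − v))](a p, a p q) · (a² p)`. [folklore] -/
theorem boxTriangle_jacobian_identity {a p q : ℝ} (ha : a ≠ 0) (hp : p ≠ 0)
    (h : 1 - a * p * q ≠ 0) :
    a / (1 - a * p * q) = 1 / (a * p * (1 - a * p * q)) * (a ^ 2 * p) := by
  field_simp

/-! ### The chart `Φ(p, q) = (a p, a p q)` of the plane -/

/-- The coordinates of the chart. [folklore] -/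
theorem boxTriangle_map_apply (a : ℝ) (Φ : (Fin 2 → ℝ) → (Fin 2 → ℝ))
    (hΦ : ∀ p, Φ p = ![a * p 0, a * p 0 * p 1]) (p : Fin 2 → ℝ) :
    Φ p 0 = a * p 0 ∧ Φ p 1 = a * p 0 * p 1 := by
  rw [hΦ]
  exact ⟨rfl, rfl⟩

/-- The chart is injective on the open square (indeed on `{p₀ ≠ 0}`) for `a ≠ 0`. [folklore] -/
theorem boxTriangle_map_injOn {a : ℝ} (ha : a ≠ 0) (Φ : (Fin 2 → ℝ) → (Fin 2 → ℝ))
    (hΦ : ∀ p, Φ p = ![a * p 0, a * p 0 * p 1]) : InjOn Φ (openUnitCube 2) := by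
  intro p hp q _ h
  have hp0 : p 0 ≠ 0 := (hp 0).1.ne'
  have h0 : a * p 0 = a * q 0 := by
    rw [← (boxTriangle_map_apply a Φ hΦ p).1, ← (boxTriangle_map_apply a Φ hΦ q).1, h]
  have h1 : a * p 0 * p 1 = a * q 0 * q 1 := by
    rw [← (boxTriangle_map_apply a Φ hΦ p).2, ← (boxTriangle_map_apply a Φ hΦ q).2, h]
  have e0 : p 0 = q 0 := mul_left_cancel₀ ha h0
  have e1 : p 1 = q 1 := by
    rw [← e0] at h1
    exact mul_left_cancel₀ (mul_ne_zero ha hp0) h1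
  funext i
  fin_cases i
  exacts [e0, e1]

/-- **The image of the open square under the chart** is the triangle `{0 < v < u < a}` (`0 < a`):
the inverse is `(u, v) ↦ (u/a, v/u)`. [folklore] -/
theorem boxTriangle_map_image {a : ℝ} (ha : 0 < a) (Φ : (Fin 2 → ℝ) → (Fin 2 → ℝ))
    (hΦ : ∀ p, Φ p = ![a * p 0, a * p 0 * p 1]) :
    Φ '' openUnitCube 2 = {w : Fin 2 → ℝ | 0 < w 1 ∧ w 1 < w 0 ∧ w 0 < a} := by
  ext w
  constructor
  · rintro ⟨p, hp, rfl⟩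
    obtain ⟨h0, h0', h1, h1'⟩ := boxTriangle_mem_open hp
    simp only [mem_setOf_eq, (boxTriangle_map_apply a Φ hΦ p).1,
      (boxTriangle_map_apply a Φ hΦ p).2]
    have hap : 0 < a * p 0 := mul_pos ha h0
    refine ⟨mul_pos hap h1, ?_, ?_⟩
    · calc a * p 0 * p 1 < a * p 0 * 1 := mul_lt_mul_of_pos_left h1' hap
        _ = a * p 0 := mul_one _
    · calc a * p 0 < a * 1 := mul_lt_mul_of_pos_left h0' ha
        _ = a := mul_one _
  · rintro ⟨h1, h2, h3⟩
    have hw0 : 0 < w 0 := h1.trans h2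
    refine ⟨![w 0 / a, w 1 / w 0], ?_, ?_⟩
    · intro i
      fin_cases i
      · exact ⟨div_pos hw0 ha, (div_lt_one ha).2 h3⟩
      · exact ⟨div_pos h1 hw0, (div_lt_one hw0).2 h2⟩
    · rw [hΦ]
      refine funext (Fin.forall_fin_two.2 ⟨?_, ?_⟩)
      · simp only [Matrix.cons_val_zero]
        field_simp
      · simp only [Matrix.cons_val_zero, Matrix.cons_val_one]
        field_simp

/-- The chart is a `ℚ`-semialgebraic map on every `ℚ`-semialgebraic set when `a` is real
algebraic: its coordinates `a·X₀`, `a·X₀X₁` are `ℚ`-polynomials times the `ℚ`-definable constant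
`a` (`isSemialgebraicFunOn_const_of_isAlgebraic`). [cite: KontsevichZagier2001, §1.1] -/
theorem boxTriangle_map_isSemialgebraicMapOn {a : ℝ} (ha : IsAlgebraic ℚ a)
    (Φ : (Fin 2 → ℝ) → (Fin 2 → ℝ)) (hΦ : ∀ p, Φ p = ![a * p 0, a * p 0 * p 1])
    {σ : Set (Fin 2 → ℝ)} (hσ : IsSemialgebraic ℚ σ) : IsSemialgebraicMapOn ℚ σ Φ := by
  have hc : IsSemialgebraicFunOn ℚ σ (fun _ => a) :=
    isSemialgebraicFunOn_const_of_isAlgebraic hσ ha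
  have h0 : IsSemialgebraicFunOn ℚ σ (fun p => a * p 0) :=
    (IsSemialgebraicFunOn.mul_holds hc
      (isSemialgebraicFunOn_aeval hσ (X 0 : MvPolynomial (Fin 2) ℚ))).congr fun p _ => by
        simp only [Pi.mul_apply, aeval_X]
  have h1 : IsSemialgebraicFunOn ℚ σ (fun p => a * p 0 * p 1) :=
    (IsSemialgebraicFunOn.mul_holds hc
      (isSemialgebraicFunOn_aeval hσ (X 0 * X 1 : MvPolynomial (Fin 2) ℚ))).congr fun p _ => by
        simp only [Pi.mul_apply, map_mul, aeval_X, mul_assoc]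
  refine IsSemialgebraicMapOn.of_forall hσ (Fin.forall_fin_two.2 ⟨?_, ?_⟩)
  · exact h0.congr fun p _ => (boxTriangle_map_apply a Φ hΦ p).1.symm
  · exact h1.congr fun p _ => (boxTriangle_map_apply a Φ hΦ p).2.symm

/-- **The derivative of the chart and its determinant.** At `p` the linear map of matrix
`!![a, 0; a p₁, a p₀]` is the Fréchet derivative of `Φ`, and its determinant is `a² p₀`.
[folklore] -/
theorem boxTriangle_map_hasFDerivAt_det (a : ℝ) (Φ : (Fin 2 → ℝ) → (Fin 2 → ℝ))
    (hΦ : ∀ p, Φ p = ![a * p 0, a * p 0 * p 1]) (p : Fin 2 → ℝ) :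
    ∃ L : (Fin 2 → ℝ) →L[ℝ] (Fin 2 → ℝ), HasFDerivAt Φ L p ∧ L.det = a ^ 2 * p 0 := by
  set M : Matrix (Fin 2) (Fin 2) ℝ := !![a, 0; a * p 1, a * p 0] with hM
  refine ⟨LinearMap.toContinuousLinearMap (Matrix.toLin' M), ?_, ?_⟩
  · -- derivative, componentwise
    refine hasFDerivAt_pi'' (Fin.forall_fin_two.2 ⟨?_, ?_⟩)
    · have hf : (fun x => Φ x 0) = fun x : Fin 2 → ℝ => a * x 0 :=
        funext fun x => (boxTriangle_map_apply a Φ hΦ x).1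
      rw [hf]
      refine ((hasFDerivAt_apply (𝕜 := ℝ) (0 : Fin 2) p).const_mul a).congr_fderiv ?_
      ext v
      simp [hM, Matrix.toLin'_apply, dotProduct, Fin.sum_univ_two]
    · have hf : (fun x => Φ x 1) = fun x : Fin 2 → ℝ => a * x 0 * x 1 :=
        funext fun x => (boxTriangle_map_apply a Φ hΦ x).2
      rw [hf]
      refine (((hasFDerivAt_apply (𝕜 := ℝ) (0 : Fin 2) p).const_mul a).fun_mul
        (hasFDerivAt_apply (𝕜 := ℝ) (1 : Fin 2) p)).congr_fderiv ?_
      ext v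
      simp [hM, Matrix.toLin'_apply, dotProduct, Fin.sum_univ_two]
      ring
  · -- determinant
    rw [LinearMap.det_toContinuousLinearMap, LinearMap.det_toLin', hM, Matrix.det_fin_two_of]
    ring

/-! ### The stub -/

/-- **Registered stub `stub_boxTriangleBridge`** (W5 of the growth line `bloch-suslin-rational-dilog`
of crux `ReductionRigidity`, stmt-KontsevichZagierPeriods-3407): THE BOX–TRIANGLE BRIDGE
`[□², a/(1 − a p₀ p₁)] ≡ [{0 < v < u < a}, 1/(u(1 − v))]` for real algebraic `0 < a ≤ 1`, inside the
calculus of moves. The box is first restricted to the open square `(0,1)²` (its boundary is null,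
rule (1a)); there `a p₀ p₁ < 1`, so the prescribed integrand applies, and the chart
`Φ(p, q) = (a p, a p q)` — `ℚ`-semialgebraic since `a` is real algebraic, injective, of Jacobian
`a² p > 0`, with image the triangle `{0 < v < u < a}` — pulls `du dv/(u(1 − v))` back to
`a dp dq/(1 − a p q)`: ONE change of variables (rule (2)). [cite: KontsevichZagier2001, §1.2] -/
theorem stub_boxTriangleBridge : ∀ (a : ℝ), IsAlgebraic ℚ a → 0 < a → a ≤ 1 →
    ∀ (r T : IntegralRep 2), r.domain = cube 2 →
    EqOn r.integrand (fun p => a / (1 - a * p 0 * p 1)) (cube 2 ∩ {p | a * p 0 * p 1 < 1}) →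
    T.domain = {w | 0 < w 1 ∧ w 1 < w 0 ∧ w 0 < a} →
    EqOn T.integrand (fun w => 1 / (w 0 * (1 - w 1))) {w | 0 < w 1 ∧ w 1 < w 0 ∧ w 0 < a} →
    KZ.of r - KZ.of T ∈ KZ.relations := by
  intro a ha ha0 ha1 r T hrd hri hTd hTi
  -- the chart
  set Φ : (Fin 2 → ℝ) → (Fin 2 → ℝ) := fun p => ![a * p 0, a * p 0 * p 1]
  have hΦ : ∀ p, Φ p = ![a * p 0, a * p 0 * p 1] := fun _ => rfl
  -- rule (1a): restrict the box to the open square (null boundary)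
  have hOr : openUnitCube 2 ⊆ r.domain := by
    rw [hrd]
    exact openUnitCube_subset_cube
  obtain ⟨R, hRd, hRi, h1⟩ : ∃ R : IntegralRep 2, R.domain = openUnitCube 2 ∧
      R.integrand = r.integrand ∧ KZ.of r - KZ.of R ∈ KZ.relations :=
    ⟨r.restrict _ isSemialgebraic_openUnitCube hOr, rfl, rfl,
      r.of_sub_of_restrict_mem_relations isSemialgebraic_openUnitCube hOr (by
        rw [hrd]
        exact Summit.KontsevichZagierPeriods.FurushoPentagon.PentagonInKZ.SimplexToCube.volume_cube_diff_openUnitCube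
          2)⟩
  -- the data of the move
  have hsa : IsSemialgebraicMapOn ℚ R.domain Φ := by
    rw [hRd]
    exact boxTriangle_map_isSemialgebraicMapOn ha Φ hΦ isSemialgebraic_openUnitCube
  have hinj : InjOn Φ R.domain := by
    rw [hRd]
    exact boxTriangle_map_injOn ha0.ne' Φ hΦ
  have himage : T.domain = Φ '' R.domain := by
    rw [hRd, hTd]
    exact (boxTriangle_map_image ha0 Φ hΦ).symm
  choose Φ' hΦ'd hΦ'det using boxTriangle_map_hasFDerivAt_det a Φ hΦ
  -- rule (2): `[R] − [T]` is one change-of-variables move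
  have h2 : KZ.of R - KZ.of T ∈ KZ.relations := by
    refine changeOfVariablesRel_subset_relations
      ⟨2, R, T, Φ, Φ', hsa, fun x _ => (hΦ'd x).hasFDerivWithinAt, hinj, himage,
        fun x hx => ?_, rfl⟩
    rw [hRd] at hx
    obtain ⟨h0, h0', -, h1'⟩ := boxTriangle_mem_open hx
    have hlt : a * x 0 * x 1 < 1 := boxTriangle_prod_lt_one ha0 ha1 h0 h0' h1'
    have hxT : Φ x ∈ {w : Fin 2 → ℝ | 0 < w 1 ∧ w 1 < w 0 ∧ w 0 < a} := by
      rw [← boxTriangle_map_image ha0 Φ hΦ]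
      exact mem_image_of_mem Φ hx
    have hpos : 0 < a ^ 2 * x 0 := mul_pos (pow_pos ha0 2) h0
    rw [hRi, hri ⟨openUnitCube_subset_cube hx, hlt⟩, hTi hxT, hΦ'det x, abs_of_pos hpos]
    show a / (1 - a * x 0 * x 1) = 1 / (Φ x 0 * (1 - Φ x 1)) * (a ^ 2 * x 0)
    rw [(boxTriangle_map_apply a Φ hΦ x).1, (boxTriangle_map_apply a Φ hΦ x).2]
    exact boxTriangle_jacobian_identity ha0.ne' h0.ne' (sub_pos.2 hlt).ne'
  -- assemble
  have hsum : KZ.of r - KZ.of T = (KZ.of r - KZ.of R) + (KZ.of R - KZ.of T) := by abel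
  rw [hsum]
  exact KZ.relations.add_mem h1 h2

end Summit.KontsevichZagierPeriods.HermiteRigidity.ReductionRigidity

end
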